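import Summits.RiemannHypothesis.RiemannHypothesis.Theses.RuelleBand
import Summits.RiemannHypothesis.RiemannHypothesis.Theorems.RuelleBandCofiniteCriticalLineStubCalibrationENDOfCofiniteAux
import Summits.RiemannHypothesis.RiemannHypothesis.Theorems.RuelleBandCofiniteCriticalLineStubExpPolyDominates
import Summits.RiemannHypothesis.RiemannHypothesis.Theorems.RuelleBandCofiniteCriticalLineStubEntireEqZeroOfDistinctDensity
import Summits.RiemannHypothesis.RiemannHypothesis.Theorems.RuelleBandCofiniteCriticalLineStubDistinctZeroCountGeSelberg
import HarnessLib

set_option linter.dupNamespace false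

/-!
# Calibration `crux ⟹ END` of line `cofinite-weil-index-staircase` — the registered stub
`stub_calibration_END_of_cofinite`

Crux `Summit.RiemannHypothesis.RiemannHypothesis.Theses.RuelleBand.CofiniteCriticalLine` (item
stmt-RiemannHypothesis-2064), line `cofinite-weil-index-staircase`, lead c2 (2026-08-16).

`stub_calibration_END_of_cofinite_unconditional : CofiniteCriticalLine → END` (UNCONDITIONAL), END being
the line's bet `stub_eventuallyNondegenerate` verbatim (`∃ a₀ ∀ a ≥ a₀`, the closed Weil form on
`[-a, a]` has no non-zero null vector in its form domain); the registered stub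
`stub_calibration_END_of_cofinite : Anderson1983_levinson_simple → CofiniteCriticalLine → END` is the
special case that ignores its first hypothesis (the stub was registered before the distinct-zero count
was made unconditional: Stub C4 `stub_distinctZeroCount_ge_selberg`, from Selberg's theorem PROVED in the
tree, replaces Anderson's named fact).  Together with the line's composition (END ⟹ crux, landed stubs)
this makes the bet EXACTLY the crux.  It also re-proves the RH-calibration `stub_calibration_END_of_RH`
(beyond some `a₀`) without Montgomery's pair correlation.

Proof.  Under the crux the off-line non-trivial zeros form a finite set `E` (reflection-closed under
`ρ ↦ 1 − ρ̄`, `Re ρ ≠ 1/2` on `E`, `= 1/2` off `E`).  Fix a bump `φ` with `Re φ̂ > 0` at every ordinate of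
`E` (`stub_cofiniteWeilCriterion_bump`), supported in `[−R, R]`; let `K = (Σ_E m) · P_E(φ)` and let `L`
be the length given by Stub C2 (`stub_expPolyDominates`) for the exponents `1/2 − ρ`, weights
`m(ρ) conj φ̂(1 − ρ̄)` (`ρ ∈ E`) and the bound `K`; put `a₀ = L + R`.  Given a window `a ≥ a₀` and a
would-be null vector `u` with approximants `gₙ`:
`Re Q(gₙ) → 0` (Aux, no positivity); `ĝₙ → û` pointwise (RH-Aux 1); splitting `Re Q` along `E` (Aux)
gives `P_E(gₙ) → −F`, `F = Re Σ_E m(ρ) û(ρ) conj û(1−ρ̄)`, so `−F ≥ 0` and `−F ≤ (Σ_E m) Σ_E |û(ρ)|²`;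
the polar split (Aux, Stub C1) and `W(gₙ ⋆ h̃) → 0` give `|Σ_E m(ρ) û(ρ) conj ĥ(1−ρ̄)|² ≤ (−F) P_E(h)`
for every window test `h`; for `h = φ(· − x)`, `|x| ≤ L`, the right side is `≤ K Σ_E |û(ρ)|²` and the
left side is `|Σ_E c_ρ û(ρ) e^{(1/2−ρ)x}|²`, so Stub C2 forces `û = 0` on `E`; then `F = 0`,
`P_E(gₙ) → 0`, `û = 0` at every on-line zero too, `û ≡ 0` by Stubs C5 + C4
(`stub_entire_eq_zero_of_distinct_density stub_distinctZeroCount_ge_selberg`: Jensen against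
`N_d(T) ≥ c₁ T log T`, Selberg), and `u = 0` a.e. (RH-Aux 1) — contradiction.
-/

noncomputable section

open Complex MeasureTheory Filter Set
open scoped BigOperators Topology ComplexConjugate

namespace Summit.RiemannHypothesis.RiemannHypothesis.Theorems.RuelleBandCofiniteCriticalLine

open Literature.NumberTheory.LFunctions

/-! ### The exceptional set under the crux -/

/-- **The off-line zeros as a finite set of non-trivial zeros.** Under the crux there is a finite set
`E` of non-trivial zeros such that `ρ ∈ E ↔ Re ρ ≠ 1/2`. [folklore] -/
theorem stub_calibration_END_of_cofinite_exists_finset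
    (h5 : Summit.RiemannHypothesis.RiemannHypothesis.Theses.RuelleBand.CofiniteCriticalLine) :
    ∃ E : Finset ZetaZeros.riemannZetaNontrivialZeros,
      ∀ ρ : ZetaZeros.riemannZetaNontrivialZeros, ρ ∈ E ↔ (ρ : ℂ).re ≠ 1 / 2 := by
  have hfin : {ρ : ZetaZeros.riemannZetaNontrivialZeros | (ρ : ℂ).re ≠ 1 / 2}.Finite := by
    have hsub : {ρ : ZetaZeros.riemannZetaNontrivialZeros | (ρ : ℂ).re ≠ 1 / 2} ⊆
        Subtype.val ⁻¹' {s : ℂ | riemannZeta s = 0 ∧ 0 < s.re ∧ s.re < 1 ∧ s.re ≠ 1 / 2} := by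
      intro ρ hρ
      exact ⟨ZetaZeros.riemannZetaNontrivialZeros.zeta_eq_zero ρ.2,
        ZetaZeros.riemannZetaNontrivialZeros.re_pos ρ.2,
        ZetaZeros.riemannZetaNontrivialZeros.re_lt_one ρ.2, hρ⟩
    exact (h5.preimage Subtype.val_injective.injOn).subset hsub
  refine ⟨hfin.toFinset, fun ρ => ?_⟩
  rw [Set.Finite.mem_toFinset]
  rfl

/-! ### Limits of the finite off-line sums along the approximating sequence -/

/-- Finite off-line sums pass to the limit: if `ĝₙ(s) → û(s)` for every `s`, then
`Σ_{ρ∈E} m(ρ) ĝₙ(ρ) conj ĥ(1 − ρ̄) → Σ_{ρ∈E} m(ρ) û(ρ) conj ĥ(1 − ρ̄)` for a FIXED `h`. [folklore] -/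
theorem stub_calibration_END_of_cofinite_tendsto_polarE (E : Finset ZetaZeros.riemannZetaNontrivialZeros)
    {G : ℕ → ℂ → ℂ} {U : ℂ → ℂ} (hG : ∀ s, Tendsto (fun n => G n s) atTop (𝓝 (U s))) (H : ℂ → ℂ) :
    Tendsto (fun n => ∑ ρ ∈ E, (riemannZetaZeroOrder (ρ : ℂ) : ℂ) * (G n ρ * conj (H (1 - conj (ρ : ℂ)))))
      atTop (𝓝 (∑ ρ ∈ E, (riemannZetaZeroOrder (ρ : ℂ) : ℂ) * (U ρ * conj (H (1 - conj (ρ : ℂ)))))) := by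
  refine tendsto_finsetSum _ fun ρ _ => ?_
  exact tendsto_const_nhds.mul ((hG ρ).mul tendsto_const_nhds)

/-- Finite off-line sums pass to the limit (diagonal case): if `ĝₙ(s) → û(s)` for every `s`, then
`Σ_{ρ∈E} m(ρ) ĝₙ(ρ) conj ĝₙ(1 − ρ̄) → Σ_{ρ∈E} m(ρ) û(ρ) conj û(1 − ρ̄)`. [folklore] -/
theorem stub_calibration_END_of_cofinite_tendsto_diagE (E : Finset ZetaZeros.riemannZetaNontrivialZeros)
    {G : ℕ → ℂ → ℂ} {U : ℂ → ℂ} (hG : ∀ s, Tendsto (fun n => G n s) atTop (𝓝 (U s))) :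
    Tendsto (fun n => ∑ ρ ∈ E, (riemannZetaZeroOrder (ρ : ℂ) : ℂ) *
        (G n ρ * conj (G n (1 - conj (ρ : ℂ))))) atTop
      (𝓝 (∑ ρ ∈ E, (riemannZetaZeroOrder (ρ : ℂ) : ℂ) * (U ρ * conj (U (1 - conj (ρ : ℂ)))))) := by
  refine tendsto_finsetSum _ fun ρ _ => ?_
  refine tendsto_const_nhds.mul ((hG ρ).mul ?_)
  exact (Complex.continuous_conj.tendsto _).comp (hG _)

/-- **Crude bound on the off-line form**: if `E` is closed under `ρ ↦ 1 − ρ̄`, then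
`|Σ_{ρ∈E} m(ρ) w(ρ) conj w(1 − ρ̄)| ≤ (Σ_{ρ∈E} m(ρ)) · Σ_{ρ∈E} |w(ρ)|²`
(`|w(ρ)||w(1−ρ̄)| ≤ (|w(ρ)|² + |w(1−ρ̄)|²)/2 ≤ Σ_E |w|²`). [folklore] -/
theorem stub_calibration_END_of_cofinite_norm_diagE_le (E : Finset ZetaZeros.riemannZetaNontrivialZeros)
    (hErefl : ∀ ρ ∈ E, WeilConverse.reflect ρ ∈ E) (w : ℂ → ℂ) :
    ‖∑ ρ ∈ E, (riemannZetaZeroOrder (ρ : ℂ) : ℂ) * (w ρ * conj (w (1 - conj (ρ : ℂ))))‖ ≤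
      (∑ ρ ∈ E, (riemannZetaZeroOrder (ρ : ℂ) : ℝ)) * ∑ ρ ∈ E, ‖w ρ‖ ^ 2 := by
  have hm0 : ∀ ρ : ZetaZeros.riemannZetaNontrivialZeros, (0 : ℝ) ≤ riemannZetaZeroOrder (ρ : ℂ) :=
    fun ρ => by
      exact_mod_cast le_trans zero_le_one (ZetaZeros.riemannZetaNontrivialZeros.one_le_order ρ.2)
  set S : ℝ := ∑ ρ ∈ E, ‖w ρ‖ ^ 2 with hS
  have hS0 : 0 ≤ S := Finset.sum_nonneg fun ρ _ => sq_nonneg _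
  have hle : ∀ ρ ∈ E, ‖w ρ‖ ^ 2 ≤ S := fun ρ hρ => by
    rw [hS]
    exact Finset.single_le_sum (f := fun ρ : ZetaZeros.riemannZetaNontrivialZeros => ‖w (ρ : ℂ)‖ ^ 2)
      (fun ρ _ => sq_nonneg _) hρ
  calc ‖∑ ρ ∈ E, (riemannZetaZeroOrder (ρ : ℂ) : ℂ) * (w ρ * conj (w (1 - conj (ρ : ℂ))))‖
      ≤ ∑ ρ ∈ E, ‖(riemannZetaZeroOrder (ρ : ℂ) : ℂ) * (w ρ * conj (w (1 - conj (ρ : ℂ))))‖ :=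
        norm_sum_le _ _
    _ ≤ ∑ ρ ∈ E, (riemannZetaZeroOrder (ρ : ℂ) : ℝ) * S := by
        refine Finset.sum_le_sum fun ρ hρ => ?_
        rw [norm_mul, norm_mul, Complex.norm_conj, Complex.norm_intCast, abs_of_nonneg (hm0 ρ)]
        refine mul_le_mul_of_nonneg_left ?_ (hm0 ρ)
        have h1 := hle ρ hρ
        have h2 : ‖w (1 - conj (ρ : ℂ))‖ ^ 2 ≤ S := by
          have := hle (WeilConverse.reflect ρ) (hErefl ρ hρ)
          simpa only [WeilConverse.coe_reflect] using this
        nlinarith [sq_nonneg (‖w ρ‖ - ‖w (1 - conj (ρ : ℂ))‖), norm_nonneg (w ρ),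
          norm_nonneg (w (1 - conj (ρ : ℂ)))]
    _ = (∑ ρ ∈ E, (riemannZetaZeroOrder (ρ : ℂ) : ℝ)) * S := by rw [Finset.sum_mul]

/-! ### The registered calibration stub -/

/-- **Calibration from below — `crux ⟹ END`, UNCONDITIONAL.**  Assuming the crux
`CofiniteCriticalLine`, there is `a₀` such that for every window `a ≥ a₀` the closed Weil form on
`[-a, a]` has no non-zero null vector in its form domain — the bet `stub_eventuallyNondegenerate` of
line `cofinite-weil-index-staircase` verbatim.  See the module docstring for the proof (finite off-line
set `E`; `Re Q(gₙ) → 0`; the off-line values of `û` are pinned by an exponential-polynomial inequality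
on the translates of one bump, Stub C2; then `û` vanishes at every non-trivial zero and is `≡ 0` by
Jensen against Selberg's `N_d(T) ≫ T log T`, Stubs C5 + C4).  Hence END ⟺ crux (given the line's
composition). [folklore] -/
theorem stub_calibration_END_of_cofinite_unconditional :
    Summit.RiemannHypothesis.RiemannHypothesis.Theses.RuelleBand.CofiniteCriticalLine →
    ∃ a₀ : ℝ, ∀ a : ℝ, a₀ ≤ a →
      ¬ ∃ (u : ℝ → ℂ) (g : ℕ → ℝ → ℂ), MemLp u 2 volume ∧ ¬ (u =ᵐ[volume] 0) ∧
          (∀ n, IsWeilTest (g n) ∧ tsupport (g n) ⊆ Set.Icc (-a) a) ∧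
          Tendsto (fun n => ∫ t, ‖g n t - u t‖ ^ 2) atTop (𝓝 0) ∧
          Tendsto (fun q : ℕ × ℕ => (weilQuadratic (g q.1 - g q.2)).re) atTop (𝓝 0) ∧
          ∀ h : ℝ → ℂ, IsWeilTest h → tsupport h ⊆ Set.Icc (-a) a →
            Tendsto (fun n => weilFunctional (weilConv (g n) (weilReflect h))) atTop (𝓝 0) := by
  intro h5
  classical
  -- the exceptional set
  obtain ⟨E, hEiff⟩ := stub_calibration_END_of_cofinite_exists_finset h5
  have hE : ∀ ρ : ZetaZeros.riemannZetaNontrivialZeros, ρ ∉ E → (ρ : ℂ).re = 1 / 2 := fun ρ hρ => by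
    by_contra hne
    exact hρ ((hEiff ρ).2 hne)
  have hEoff : ∀ ρ ∈ E, (ρ : ℂ).re ≠ 1 / 2 := fun ρ hρ => (hEiff ρ).1 hρ
  have hErefl : ∀ ρ ∈ E, WeilConverse.reflect ρ ∈ E := fun ρ hρ => by
    rw [hEiff, WeilConverse.coe_reflect, WeilConverse.one_sub_conj_re]
    intro h
    exact hEoff ρ hρ (by linarith)
  have hm0 : ∀ ρ : ZetaZeros.riemannZetaNontrivialZeros, (0 : ℝ) ≤ riemannZetaZeroOrder (ρ : ℂ) :=
    fun ρ => by
      exact_mod_cast le_trans zero_le_one (ZetaZeros.riemannZetaNontrivialZeros.one_le_order ρ.2)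
  -- the bump `φ`, non-vanishing at the reflected points of `E`
  set Y : ℝ := ∑ ρ ∈ E, |(ρ : ℂ).im| with hY
  obtain ⟨φ, hφ, hφpos⟩ := stub_cofiniteWeilCriterion_bump Y
  have hφne : ∀ ρ ∈ E, weilMellin φ (1 - conj (ρ : ℂ)) ≠ 0 := by
    intro ρ hρ hzero
    have him : |(ρ : ℂ).im| ≤ Y :=
      Finset.single_le_sum (f := fun ρ : ZetaZeros.riemannZetaNontrivialZeros => |(ρ : ℂ).im|)
        (fun _ _ => abs_nonneg _) hρ
    have h := hφpos (1 - (ρ : ℂ).re) (ρ : ℂ).im him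
    have e : ((1 - (ρ : ℂ).re : ℝ) : ℂ) + ((ρ : ℂ).im : ℂ) * I = 1 - conj (ρ : ℂ) := by
      apply Complex.ext <;> simp
    rw [e, hzero, Complex.zero_re] at h
    exact lt_irrefl _ h
  -- the support radius `R` of `φ`
  obtain ⟨R, hR0, hRsupp⟩ : ∃ R : ℝ, 0 ≤ R ∧ tsupport φ ⊆ Icc (-R) R := by
    obtain ⟨r, hr⟩ := hφ.2.isCompact.isBounded.subset_closedBall 0
    refine ⟨max r 0, le_max_right _ _, hr.trans ?_⟩
    rw [Real.closedBall_eq_Icc, zero_sub, zero_add]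
    exact Icc_subset_Icc (neg_le_neg (le_max_left _ _)) (le_max_left _ _)
  -- the constants of Stub C2
  set Pφ : ℝ := ∑' ρ : ZetaZeros.riemannZetaNontrivialZeros,
    (if ρ ∈ E then (0 : ℝ) else (riemannZetaZeroOrder (ρ : ℂ) : ℝ) * ‖weilMellin φ ρ‖ ^ 2) with hPφ
  set K : ℝ := (∑ ρ ∈ E, (riemannZetaZeroOrder (ρ : ℂ) : ℝ)) * Pφ with hK
  set lam : ZetaZeros.riemannZetaNontrivialZeros → ℂ := fun ρ => 1 / 2 - (ρ : ℂ) with hlam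
  set c : ZetaZeros.riemannZetaNontrivialZeros → ℂ := fun ρ =>
    (riemannZetaZeroOrder (ρ : ℂ) : ℂ) * conj (weilMellin φ (1 - conj (ρ : ℂ))) with hc
  have hinj : Set.InjOn lam ↑E := fun ρ _ ρ' _ h => by
    apply Subtype.ext
    have : (1 / 2 : ℂ) - (ρ : ℂ) = 1 / 2 - (ρ' : ℂ) := h
    linear_combination -this
  have hlamre : ∀ ρ ∈ E, (lam ρ).re ≠ 0 := fun ρ hρ => by
    simp only [hlam, Complex.sub_re]
    intro h
    exact hEoff ρ hρ (by norm_num at h; linarith)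
  have hcne : ∀ ρ ∈ E, c ρ ≠ 0 := fun ρ hρ => by
    refine mul_ne_zero ?_ ((map_ne_zero _).2 (hφne ρ hρ))
    exact_mod_cast (lt_of_lt_of_le one_pos (ZetaZeros.riemannZetaNontrivialZeros.one_le_order ρ.2)).ne'
  obtain ⟨L, hL0, hL⟩ := stub_expPolyDominates E lam c hinj hlamre hcne K
  -- the threshold
  refine ⟨L + R, fun a ha => ?_⟩
  rintro ⟨u, g, hu, hu0, hg, hL2, hC, hW⟩
  have ha0 : 0 ≤ a := by linarith
  -- localisation of `u`, pointwise convergence of the transforms, `Re Q(gₙ) → 0`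
  have hz : ∀ᵐ t : ℝ, t ∉ Icc (-a) a → u t = 0 :=
    stub_calibration_END_of_RH_ae_zero_off hu hg hL2
  have hmel : ∀ s : ℂ, Tendsto (fun n => weilMellin (g n) s) atTop (𝓝 (weilMellin u s)) :=
    fun s => stub_calibration_END_of_RH_tendsto_weilMellin hu hz hg hL2 s
  have hQ : Tendsto (fun n => (weilQuadratic (g n)).re) atTop (𝓝 0) :=
    stub_calibration_END_of_cofinite_tendsto_re_weilQuadratic (fun n => (hg n).1) hC
      (fun m => hW (g m) (hg m).1 (hg m).2)
  -- the off-line form of the limit and the on-line energies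
  set F : ℝ := (∑ ρ ∈ E, (riemannZetaZeroOrder (ρ : ℂ) : ℂ) *
    (weilMellin u ρ * conj (weilMellin u (1 - conj (ρ : ℂ))))).re with hF
  set P : ℕ → ℝ := fun n => ∑' ρ : ZetaZeros.riemannZetaNontrivialZeros,
    (if ρ ∈ E then (0 : ℝ) else (riemannZetaZeroOrder (ρ : ℂ) : ℝ) * ‖weilMellin (g n) ρ‖ ^ 2) with hP
  have hP0 : ∀ n, 0 ≤ P n := fun n => stub_calibration_END_of_cofinite_onLine_nonneg E (g n)
  have hPlim : Tendsto P atTop (𝓝 (-F)) := by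
    have hdiag := (Complex.continuous_re.tendsto _).comp
      (stub_calibration_END_of_cofinite_tendsto_diagE E hmel)
    have e : P = fun n => (weilQuadratic (g n)).re - (∑ ρ ∈ E, (riemannZetaZeroOrder (ρ : ℂ) : ℂ) *
        (weilMellin (g n) ρ * conj (weilMellin (g n) (1 - conj (ρ : ℂ))))).re := by
      funext n
      have := stub_calibration_END_of_cofinite_re_weilQuadratic_eq (E := E) hE (hg n).1
      simp only [hP]
      linarith
    rw [e, show -F = 0 - F by ring]
    exact hQ.sub hdiag
  have hFle : 0 ≤ -F := ge_of_tendsto' hPlim fun n => hP0 n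
  have hFbound : -F ≤ (∑ ρ ∈ E, (riemannZetaZeroOrder (ρ : ℂ) : ℝ)) *
      ∑ ρ ∈ E, ‖weilMellin u ρ‖ ^ 2 := by
    have h := stub_calibration_END_of_cofinite_norm_diagE_le E hErefl (weilMellin u)
    have h' : |F| ≤ _ := (abs_re_le_norm _).trans h
    exact (neg_le_abs F).trans h'
  -- the main inequality on window tests
  have hmain : ∀ h : ℝ → ℂ, IsWeilTest h → tsupport h ⊆ Icc (-a) a →
      ‖∑ ρ ∈ E, (riemannZetaZeroOrder (ρ : ℂ) : ℂ) *
          (weilMellin u ρ * conj (weilMellin h (1 - conj (ρ : ℂ))))‖ ^ 2 ≤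
        (-F) * ∑' ρ : ZetaZeros.riemannZetaNontrivialZeros,
          (if ρ ∈ E then (0 : ℝ) else (riemannZetaZeroOrder (ρ : ℂ) : ℝ) * ‖weilMellin h ρ‖ ^ 2) := by
    intro h hh hsupp
    refine stub_calibration_END_of_cofinite_sq_le_mul_of_forall (norm_nonneg _) hFle
      (stub_calibration_END_of_cofinite_onLine_nonneg E h) fun t ht => ?_
    -- pass to the limit in `‖Σ_E(gₙ)‖ ≤ ‖W(gₙ ⋆ h̃)‖ + (t P n + P_E(h)/t)/2`
    have hlimE := (continuous_norm.tendsto _).comp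
      (stub_calibration_END_of_cofinite_tendsto_polarE E hmel (weilMellin h))
    have hlimR : Tendsto (fun n => ‖weilFunctional (weilConv (g n) (weilReflect h))‖ +
        (t * P n + (∑' ρ : ZetaZeros.riemannZetaNontrivialZeros,
          (if ρ ∈ E then (0 : ℝ) else (riemannZetaZeroOrder (ρ : ℂ) : ℝ) * ‖weilMellin h ρ‖ ^ 2)) / t)
          / 2) atTop
        (𝓝 (‖(0 : ℂ)‖ + (t * (-F) + (∑' ρ : ZetaZeros.riemannZetaNontrivialZeros,
          (if ρ ∈ E then (0 : ℝ) else (riemannZetaZeroOrder (ρ : ℂ) : ℝ) * ‖weilMellin h ρ‖ ^ 2)) / t)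
          / 2)) := by
      refine ((continuous_norm.tendsto _).comp (hW h hh hsupp)).add ?_
      exact ((hPlim.const_mul t).add tendsto_const_nhds).div_const 2
    have hle : ∀ n, ‖∑ ρ ∈ E, (riemannZetaZeroOrder (ρ : ℂ) : ℂ) *
        (weilMellin (g n) ρ * conj (weilMellin h (1 - conj (ρ : ℂ))))‖ ≤
        ‖weilFunctional (weilConv (g n) (weilReflect h))‖ +
        (t * P n + (∑' ρ : ZetaZeros.riemannZetaNontrivialZeros,
          (if ρ ∈ E then (0 : ℝ) else (riemannZetaZeroOrder (ρ : ℂ) : ℝ) * ‖weilMellin h ρ‖ ^ 2)) / t)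
          / 2 := by
      intro n
      have hb := stub_calibration_END_of_cofinite_norm_sub_polarE_le (E := E) hE (hg n).1 hh ht
      have htri := norm_sub_le_norm_sub_add_norm_sub (0 : ℂ)
        (weilFunctional (weilConv (g n) (weilReflect h)))
        (∑ ρ ∈ E, (riemannZetaZeroOrder (ρ : ℂ) : ℂ) *
          (weilMellin (g n) ρ * conj (weilMellin h (1 - conj (ρ : ℂ)))))
      rw [zero_sub, norm_neg, zero_sub, norm_neg] at htri
      linarith
    have hfin := le_of_tendsto_of_tendsto' hlimE hlimR hle
    simp only [norm_zero, zero_add] at hfin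
    linarith
  -- translates of the bump: Stub C2 forces `û = 0` on `E`
  have hzeroE : ∀ ρ ∈ E, weilMellin u ρ = 0 := by
    refine hL (fun ρ => weilMellin u ρ) fun x hx => ?_
    have hsuppx : tsupport (weilTranslate φ x) ⊆ Icc (-a) a :=
      (stub_calibration_END_of_cofinite_tsupport_weilTranslate x hRsupp).trans
        (Icc_subset_Icc (by linarith [(abs_le.1 hx).1]) (by linarith [(abs_le.1 hx).2]))
    have h1 := hmain (weilTranslate φ x) (hφ.weilTranslate x) hsuppx
    rw [stub_calibration_END_of_cofinite_onLine_weilTranslate (E := E) hE φ x,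
      stub_calibration_END_of_cofinite_polarE_weilTranslate (E := E) φ (weilMellin u) x] at h1
    calc ‖∑ i ∈ E, c i * weilMellin u i * cexp (lam i * x)‖ ^ 2
        ≤ (-F) * Pφ := h1
      _ ≤ K * ∑ i ∈ E, ‖weilMellin u i‖ ^ 2 := by
          rw [hK, mul_assoc, mul_comm Pφ, ← mul_assoc]
          exact mul_le_mul_of_nonneg_right hFbound
            (stub_calibration_END_of_cofinite_onLine_nonneg E φ)
  -- hence `F = 0`, `P n → 0`, and `û = 0` at every non-trivial zero
  have hF0 : F = 0 := by
    rw [hF]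
    rw [Finset.sum_eq_zero fun ρ hρ => by rw [hzeroE ρ hρ, zero_mul, mul_zero]]
    simp
  have hPlim0 : Tendsto P atTop (𝓝 0) := by simpa [hF0] using hPlim
  have hzero : ∀ ρ ∈ ZetaZeros.riemannZetaNontrivialZeros, weilMellin u ρ = 0 := by
    intro ρ hρ
    by_cases hmem : (⟨ρ, hρ⟩ : ZetaZeros.riemannZetaNontrivialZeros) ∈ E
    · exact hzeroE _ hmem
    · -- on-line: `m(ρ)|ĝₙ(ρ)|² ≤ P n → 0`
      have hlim0 : Tendsto (fun n => weilMellin (g n) ρ) atTop (𝓝 0) := by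
        rw [tendsto_zero_iff_norm_tendsto_zero]
        have hm1 : (1 : ℝ) ≤ riemannZetaZeroOrder ρ := by
          exact_mod_cast ZetaZeros.riemannZetaNontrivialZeros.one_le_order hρ
        have hb : ∀ n, ‖weilMellin (g n) ρ‖ ≤ Real.sqrt (P n) := fun n => by
          have h1 := stub_calibration_END_of_cofinite_term_le_onLine E (hg n).1 hmem
          have h2 : ‖weilMellin (g n) ρ‖ ^ 2 ≤ P n := by
            refine le_trans ?_ h1
            have h0 : 0 ≤ ‖weilMellin (g n) ρ‖ ^ 2 := sq_nonneg _
            change ‖weilMellin (g n) ρ‖ ^ 2 ≤ (riemannZetaZeroOrder ρ : ℝ) * ‖weilMellin (g n) ρ‖ ^ 2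
            nlinarith
          simpa only [abs_norm] using Real.abs_le_sqrt h2
        refine squeeze_zero (fun n => norm_nonneg _) hb ?_
        simpa using hPlim0.sqrt
      exact tendsto_nhds_unique (hmel ρ) hlim0
  -- `û ≡ 0` (Stubs C5 + C4: Jensen against Selberg's distinct-zero count) and `u = 0` a.e.
  have hent := stub_entire_eq_zero_of_distinct_density stub_distinctZeroCount_ge_selberg
    (stub_calibration_END_of_RH_differentiable_weilMellin hu hz) ha0
    (stub_calibration_END_of_RH_norm_weilMellin_le hu hz) hzero
  exact hu0 (stub_calibration_END_of_RH_ae_eq_zero_of_weilMellin_eq_zero hu hz hent)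

/-- **The registered calibration stub** (`Anderson1983_levinson_simple → crux → END`; the first
hypothesis is no longer needed and is ignored: `stub_calibration_END_of_cofinite_unconditional`).
[folklore] -/
theorem stub_calibration_END_of_cofinite : Anderson1983_levinson_simple →
    Summit.RiemannHypothesis.RiemannHypothesis.Theses.RuelleBand.CofiniteCriticalLine →
    ∃ a₀ : ℝ, ∀ a : ℝ, a₀ ≤ a →
      ¬ ∃ (u : ℝ → ℂ) (g : ℕ → ℝ → ℂ), MemLp u 2 volume ∧ ¬ (u =ᵐ[volume] 0) ∧
          (∀ n, IsWeilTest (g n) ∧ tsupport (g n) ⊆ Set.Icc (-a) a) ∧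
          Tendsto (fun n => ∫ t, ‖g n t - u t‖ ^ 2) atTop (𝓝 0) ∧
          Tendsto (fun q : ℕ × ℕ => (weilQuadratic (g q.1 - g q.2)).re) atTop (𝓝 0) ∧
          ∀ h : ℝ → ℂ, IsWeilTest h → tsupport h ⊆ Set.Icc (-a) a →
            Tendsto (fun n => weilFunctional (weilConv (g n) (weilReflect h))) atTop (𝓝 0) :=
  fun _ => stub_calibration_END_of_cofinite_unconditional

/-- Curried form of the calibration (crux hypothesis only). [folklore] -/
theorem stub_calibration_END_of_cofinite'
    (h5 : Summit.RiemannHypothesis.RiemannHypothesis.Theses.RuelleBand.CofiniteCriticalLine) :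
    ∃ a₀ : ℝ, ∀ a : ℝ, a₀ ≤ a →
      ¬ ∃ (u : ℝ → ℂ) (g : ℕ → ℝ → ℂ), MemLp u 2 volume ∧ ¬ (u =ᵐ[volume] 0) ∧
          (∀ n, IsWeilTest (g n) ∧ tsupport (g n) ⊆ Set.Icc (-a) a) ∧
          Tendsto (fun n => ∫ t, ‖g n t - u t‖ ^ 2) atTop (𝓝 0) ∧
          Tendsto (fun q : ℕ × ℕ => (weilQuadratic (g q.1 - g q.2)).re) atTop (𝓝 0) ∧
          ∀ h : ℝ → ℂ, IsWeilTest h → tsupport h ⊆ Set.Icc (-a) a →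
            Tendsto (fun n => weilFunctional (weilConv (g n) (weilReflect h))) atTop (𝓝 0) :=
  stub_calibration_END_of_cofinite_unconditional h5

/-- **RH-calibration recovered without Montgomery**: under RH the off-line set is empty, so
`crux ⟹ END` specialises to `RH ⟹ END` for all windows beyond some `a₀` (the landed
`stub_calibration_END_of_RH` gives every `a > 0`, using Montgomery's pair-correlation count instead of
Selberg's). [folklore] -/
theorem stub_calibration_END_of_cofinite_of_RH (hRH : RiemannHypothesis) :
    ∃ a₀ : ℝ, ∀ a : ℝ, a₀ ≤ a →
      ¬ ∃ (u : ℝ → ℂ) (g : ℕ → ℝ → ℂ), MemLp u 2 volume ∧ ¬ (u =ᵐ[volume] 0) ∧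
          (∀ n, IsWeilTest (g n) ∧ tsupport (g n) ⊆ Set.Icc (-a) a) ∧
          Tendsto (fun n => ∫ t, ‖g n t - u t‖ ^ 2) atTop (𝓝 0) ∧
          Tendsto (fun q : ℕ × ℕ => (weilQuadratic (g q.1 - g q.2)).re) atTop (𝓝 0) ∧
          ∀ h : ℝ → ℂ, IsWeilTest h → tsupport h ⊆ Set.Icc (-a) a →
            Tendsto (fun n => weilFunctional (weilConv (g n) (weilReflect h))) atTop (𝓝 0) := by
  refine stub_calibration_END_of_cofinite_unconditional (Set.Finite.subset Set.finite_empty ?_)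
  rintro s ⟨hz, h0, h1, hne⟩
  refine hne (hRH s hz ?_ ?_)
  · rintro ⟨n, hn⟩
    have : (s : ℂ).re = (-2 * ((n : ℂ) + 1)).re := by rw [hn]
    simp at this
    linarith
  · rintro rfl
    norm_num at h1

end Summit.RiemannHypothesis.RiemannHypothesis.Theorems.RuelleBandCofiniteCriticalLine

end
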